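import Summits.CriticalPhenomena.PercolationContinuityZ3.Theorems.Transplant.SharpnessRayGraph
import Literature.Barriers.CriticalPhenomena.SubexponentialGrowthZd
import Mathlib.Order.Lattice.Nat
import HarnessLib

/-!
# Transplant sharpness LXIX — the square lattice with a reinforced ray is not quasi-transitive

builds on p205010 (kernel theorem, internal audit signed; external expert review pending).
Status sentence (coordinator 2026-08-20T04:30Z): "θ(p_c) = 0 on ℤ^d, all d ≥ 2 — kernel-verified (Lean 4/Mathlib,
standard axioms); internal adversarial audit SIGNED 2026-08-20 04:29Z; external expert review pending."

Lane `prim-bschramm`, seat p5 (sharpness); memo `run/shared/lean/prim/bschramm/P5-SHARPNESS.md` §48, row 85 (kernel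
programme "RAY"): the classification cell "NOT q.t." of row 85, kernel-checked. `G_ray` (LXI `rayGraph`) has
infinitely many `Aut`-orbits: the graph-intrinsic distance from a vertex to the set of degree-two vertices (the detour
vertices `inr k`, which lie on the ray) is an automorphism invariant, and it is `≥ j` at the lattice point `(0, j)`.

* `degTwo_iff` — a vertex has exactly two neighbours iff it is a detour vertex;
* `height_le_of_walk` — the height `|y|` (zero on detour vertices) grows by at most one per edge;
* `rayDist_map` — invariance of the distance to the degree-two set under automorphisms; `le_rayDist` — its lower bound
  `j ≤ rayDist (0,j)`;
* `not_isQuasiTransitive_rayGraph` — **`¬ IsQuasiTransitive G_ray`** (the tree's `Literature.Barriers.CriticalPhenomena.IsQuasiTransitive`: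
  finitely many orbit representatives).
-/

noncomputable section

namespace Summit.CriticalPhenomena.PercolationContinuityZ3.Theorems.TransplantSharpness

namespace Ray

open Literature.Probability.Percolation Literature.Probability.LatticeModels
open Literature.Barriers.CriticalPhenomena (IsQuasiTransitive)
open SimpleGraph

/-- "Exactly two neighbours", stated through adjacency only (hence transported by automorphisms). -/
local notation3 "Deg2[" w "]" => (∃ a b : Site 2 ⊕ ℕ, a ≠ b ∧ rayGraph.Adj w a ∧ rayGraph.Adj w b ∧
  ∀ c, rayGraph.Adj w c → c = a ∨ c = b)
/-- The height: `|y|` on lattice vertices, `0` on detour vertices. -/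
local notation3 "ht[" v "]" => (Sum.elim (fun u : Site 2 => |u 1|) (fun _ : ℕ => (0 : ℤ)) v)
/-- The graph distance to the set of degree-two vertices. -/
local notation3 "rayDist[" v "]" => sInf {r : ℕ | ∃ w : Site 2 ⊕ ℕ, Deg2[w] ∧ ∃ p : rayGraph.Walk v w, p.length ≤ r}

/-! ### Degree-two vertices are the detour vertices -/

/-- A detour vertex has exactly the two ray points as neighbours. [folklore] -/
theorem degTwo_inr (k : ℕ) : Deg2[(Sum.inr k : Site 2 ⊕ ℕ)] := by
  refine ⟨Sum.inl (rayPt k false), Sum.inl (rayPt k true), ?_, (rayGraph_adj_inr_inl k _).2 (Or.inl rfl),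
    (rayGraph_adj_inr_inl k _).2 (Or.inr rfl), ?_⟩
  · intro h
    have := congrFun (Sum.inl_injective h) 0
    simp [rayPt] at this
  · rintro (c | l) hc
    · rcases (rayGraph_adj_inr_inl k c).1 hc with rfl | rfl
      · exact Or.inl rfl
      · exact Or.inr rfl
    · exact absurd hc (rayGraph_adj_inr_inr k l)

/-- A lattice vertex has at least three neighbours, so it is not of degree two. [folklore] -/
theorem not_degTwo_inl (u : Site 2) : ¬ Deg2[(Sum.inl u : Site 2 ⊕ ℕ)] := by
  rintro ⟨a, b, _, _, _, hall⟩
  -- three distinct lattice neighbours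
  have h1 : rayGraph.Adj (Sum.inl u) (Sum.inl (u + Pi.single 0 1)) :=
    (rayGraph_adj_inl_inl _ _).2 ((zdGraph_adj_iff _ _).2 ⟨0, Or.inl rfl⟩)
  have h2 : rayGraph.Adj (Sum.inl u) (Sum.inl (u - Pi.single 0 1)) :=
    (rayGraph_adj_inl_inl _ _).2 ((zdGraph_adj_iff _ _).2 ⟨0, Or.inr (by rw [sub_add_cancel])⟩)
  have h3 : rayGraph.Adj (Sum.inl u) (Sum.inl (u + Pi.single 1 1)) :=
    (rayGraph_adj_inl_inl _ _).2 ((zdGraph_adj_iff _ _).2 ⟨1, Or.inl rfl⟩)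
  have d12 : (Sum.inl (u + Pi.single 0 1) : Site 2 ⊕ ℕ) ≠ Sum.inl (u - Pi.single 0 1) := by
    intro h; have := congrFun (Sum.inl_injective h) 0; simp at this; omega
  have d13 : (Sum.inl (u + Pi.single 0 1) : Site 2 ⊕ ℕ) ≠ Sum.inl (u + Pi.single 1 1) := by
    intro h; have := congrFun (Sum.inl_injective h) 0; simp at this
  have d23 : (Sum.inl (u - Pi.single 0 1) : Site 2 ⊕ ℕ) ≠ Sum.inl (u + Pi.single 1 1) := by
    intro h; have := congrFun (Sum.inl_injective h) 0; simp at this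
  rcases hall _ h1 with e1 | e1 <;> rcases hall _ h2 with e2 | e2 <;> rcases hall _ h3 with e3 | e3
  all_goals first
    | exact d12 (e1.trans e2.symm) | exact d13 (e1.trans e3.symm) | exact d23 (e2.trans e3.symm)

/-- **Degree two characterises the detour vertices.** [folklore] -/
theorem degTwo_iff (w : Site 2 ⊕ ℕ) : Deg2[w] ↔ ∃ k : ℕ, w = Sum.inr k := by
  rcases w with u | k
  · exact ⟨fun h => absurd h (not_degTwo_inl u), by rintro ⟨k, hk⟩; cases hk⟩
  · exact ⟨fun _ => ⟨k, rfl⟩, fun _ => degTwo_inr k⟩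

/-! ### The height grows by at most one per edge -/

/-- Along an edge of `G_ray` the height changes by at most one. [folklore] -/
theorem height_le_of_adj {a b : Site 2 ⊕ ℕ} (h : rayGraph.Adj a b) : ht[a] ≤ ht[b] + 1 := by
  have key : ∀ x y : ℤ, |x - y| ≤ 1 → |x| ≤ |y| + 1 := fun x y hxy => by linarith [abs_sub_abs_le_abs_sub x y]
  rcases a with u | k <;> rcases b with v | l
  · simp only [Sum.elim_inl]
    apply key
    obtain ⟨i, hv | hu⟩ := (zdGraph_adj_iff u v).1 ((rayGraph_adj_inl_inl u v).1 h)
    · rw [hv]; fin_cases i <;> simp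
    · rw [hu]; fin_cases i <;> simp
  · rcases (rayGraph_adj_inl_inr u l).1 h with rfl | rfl <;> simp [rayPt]
  · simp only [Sum.elim_inr, Sum.elim_inl]; positivity
  · exact absurd h (rayGraph_adj_inr_inr k l)

/-- Along a walk the height changes by at most the length. [folklore] -/
theorem height_le_of_walk {a b : Site 2 ⊕ ℕ} (p : rayGraph.Walk a b) : ht[a] ≤ ht[b] + p.length := by
  induction p with
  | nil => simp
  | cons h p ih =>
    rw [Walk.length_cons]; push_cast
    linarith [height_le_of_adj h, ih]

/-! ### The distance to the degree-two set -/

/-- The set defining `rayDist[v]` is non-empty (`G_ray` joins every vertex to the detour vertex `inr 0`). [folklore] -/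
theorem rayDist_set_nonempty (v : Site 2 ⊕ ℕ) :
    ({r : ℕ | ∃ w : Site 2 ⊕ ℕ, Deg2[w] ∧ ∃ p : rayGraph.Walk v w, p.length ≤ r}).Nonempty := by
  -- a walk from `v` to `inr 0`
  have hreach : rayGraph.Reachable v (Sum.inr 0) := by
    have hinl : ∀ u u' : Site 2, rayGraph.Reachable (Sum.inl u) (Sum.inl u') := fun u u' =>
      (zdGraph_reachable u u').map
        ({ toFun := Sum.inl, map_rel' := fun h => (rayGraph_adj_inl_inl _ _).2 h } : zdGraph 2 →g rayGraph)
    have h0 : rayGraph.Reachable (Sum.inl (rayPt 0 false)) (Sum.inr 0) :=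
      (((rayGraph_adj_inl_inr _ 0).2 (Or.inl rfl)).reachable)
    rcases v with u | k
    · exact (hinl u _).trans h0
    · exact (((rayGraph_adj_inr_inl k _).2 (Or.inl rfl)).reachable.trans (hinl _ _)).trans h0
  obtain ⟨p⟩ := hreach
  exact ⟨p.length, Sum.inr 0, degTwo_inr 0, p, le_rfl⟩

/-- Automorphisms transport the degree-two property. [folklore] -/
theorem degTwo_map (γ : rayGraph ≃g rayGraph) {w : Site 2 ⊕ ℕ} (h : Deg2[w]) : Deg2[γ w] := by
  obtain ⟨a, b, hab, ha, hb, hall⟩ := h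
  refine ⟨γ a, γ b, fun h => hab (γ.injective h), γ.map_adj_iff.2 ha, γ.map_adj_iff.2 hb, fun c hc => ?_⟩
  have hc' : rayGraph.Adj w (γ.symm c) := by
    have := γ.symm.map_adj_iff.2 hc
    simpa using this
  rcases hall _ hc' with h1 | h1
  · left; rw [← h1]; simp
  · right; rw [← h1]; simp

/-- **Automorphism invariance of the distance to the degree-two set.** [folklore] -/
theorem rayDist_map (γ : rayGraph ≃g rayGraph) (v : Site 2 ⊕ ℕ) : rayDist[γ v] = rayDist[v] := by
  have key : ∀ (δ : rayGraph ≃g rayGraph) (x : Site 2 ⊕ ℕ),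
      {r : ℕ | ∃ w : Site 2 ⊕ ℕ, Deg2[w] ∧ ∃ p : rayGraph.Walk x w, p.length ≤ r} ⊆
      {r : ℕ | ∃ w : Site 2 ⊕ ℕ, Deg2[w] ∧ ∃ p : rayGraph.Walk (δ x) w, p.length ≤ r} := by
    rintro δ x r ⟨w, hw, p, hp⟩
    exact ⟨δ w, degTwo_map δ hw, p.map δ.toHom, by rwa [Walk.length_map]⟩
  apply le_antisymm
  · exact csInf_le_csInf ⟨0, fun _ _ => Nat.zero_le _⟩ (rayDist_set_nonempty v) (key γ v)
  · have h := key γ.symm (γ v)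
    rw [γ.symm_apply_apply] at h
    exact csInf_le_csInf ⟨0, fun _ _ => Nat.zero_le _⟩ (rayDist_set_nonempty (γ v)) h

/-- **The lattice point `(0, j)` is at distance `≥ j` from the degree-two set.** [folklore] -/
theorem le_rayDist (j : ℕ) : j ≤ rayDist[(Sum.inl ![0, (j : ℤ)] : Site 2 ⊕ ℕ)] := by
  obtain ⟨w, hw, p, hp⟩ := Nat.sInf_mem (rayDist_set_nonempty (Sum.inl ![0, (j : ℤ)]))
  obtain ⟨k, rfl⟩ := (degTwo_iff w).1 hw
  have h := height_le_of_walk p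
  simp only [Sum.elim_inl, Sum.elim_inr, Matrix.cons_val_one, Matrix.cons_val_fin_one, zero_add] at h
  have : (j : ℤ) ≤ p.length := by rw [abs_of_nonneg (by positivity)] at h; exact h
  have hj : j ≤ p.length := by exact_mod_cast this
  exact hj.trans hp

/-- **`G_ray` is not quasi-transitive**: the automorphism invariant `rayDist` is unbounded, so no finite set of vertices
meets every orbit. [cite: HeydenreichVanDerHofstad2017, §15.6 (p. 233)] -/
theorem not_isQuasiTransitive_rayGraph : ¬ IsQuasiTransitive rayGraph := by
  rintro ⟨V₀, hV₀⟩
  set M : ℕ := V₀.sup fun v => rayDist[v] with hM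
  obtain ⟨γ, hγ⟩ := hV₀ (Sum.inl ![0, ((M + 1 : ℕ) : ℤ)])
  have h1 : rayDist[γ (Sum.inl ![0, ((M + 1 : ℕ) : ℤ)])] ≤ M := Finset.le_sup (f := fun v => rayDist[v]) hγ
  rw [rayDist_map] at h1
  have h2 := le_rayDist (M + 1)
  omega

end Ray

end Summit.CriticalPhenomena.PercolationContinuityZ3.Theorems.TransplantSharpness
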